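import Summits.Ventures.PercRepro.Night2SevenFiveFour
import Summits.Ventures.PercRepro.Night2RigidCell

/-!
# PercRepro — the `(7, 5)` shadow row modulo SEVEN local cells (night-2, gen 18)

`shadowHall_seven_five_of_local_five` (gen 17) reduced the `(7, 5)` shadow row to the eight local cells
`(|E ∖ G|, kColoops) ∈ {(2,0), (2,1), (3,0), (3,1), (3,2), (4,1), (4,2), (4,3)}` of loopless simple rank-`7`
matroids.  The cell `(4, 3)` is the rigid cell at `q = 5` (`localShadowHall_four_three_five`, a kernel theorem),
so **`shadowHall_seven_five_of_local_seven`**: the `(7, 5)` shadow row — hence the C-025 body at `(7, 5)` through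
`c025_of_shadowHall` — for every finite matroid modulo the SEVEN cells `(2,0), (2,1), (3,0), (3,1), (3,2), (4,1),
(4,2)` alone.
-/

namespace PercRepro.Shadow

open Finset PerFlat ThmH

section SevenFive

variable {α' : Type} [DecidableEq α']

/-- **THE `(7, 5)` SHADOW ROW FOR EVERY FINITE MATROID MODULO SEVEN LOCAL CELLS**: if the local form (LI_G) holds
for loopless simple rank-`7` matroids at every rank-`6` flat `G` with `2 ≤ |E ∖ G| ≤ 4`, `kColoops + 1 ≤ |E ∖ G|`,
`kColoops ≥ |E ∖ G| − 3` and `(|E ∖ G|, kColoops) ≠ (4, 3)`, then `ShadowHall M 7 5 (phiK 7 5)` for every finite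
matroid `M`. -/
theorem shadowHall_seven_five_of_local_seven
    (hloc7 : ∀ (N : Matroid α') [N.Finite], (∀ e ∈ gr N, ∀ f ∈ gr N, e ≠ f → rkN N {e, f} = 2) →
      (∀ e ∈ gr N, N.Indep {e}) → N.eRank = ((5 + 2 : ℕ) : ℕ∞) →
      ∀ G ∈ flatsQ N (5 + 1), 2 ≤ (gr N \ G).card → (gr N \ G).card ≤ 4 →
        kColoops N G + 1 ≤ (gr N \ G).card → 1 ≤ kColoops N G + 4 - (gr N \ G).card →
        ¬ ((gr N \ G).card = 4 ∧ kColoops N G = 3) → LocalShadowHall N 5 G)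
    (M : Matroid α') [M.Finite] : ShadowHall M 7 5 (phiK 7 5) :=
  shadowHall_seven_five_of_local_five
    (fun N _ hs hl hr G hG h2 h4 hk1 hk2 => by
      by_cases hc : (gr N \ G).card = 4 ∧ kColoops N G = 3
      · exact localShadowHall_four_three_five hG hc.1 hc.2 hs
      · exact hloc7 N hs hl hr G hG h2 h4 hk1 hk2 hc) M

end SevenFive

end PercRepro.Shadow
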